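import Literature.MathematicalPhysics.QuantumFieldTheory.Balaban1983to89.B8SockHFPOfSockLetters
import Literature.MathematicalPhysics.QuantumFieldTheory.Balaban1983to89.B8Thm4TruncationLocal
import Literature.MathematicalPhysics.QuantumFieldTheory.Balaban1983to89.B8CubeMemberZd
import Literature.MathematicalPhysics.QuantumFieldTheory.Balaban1983to89.B8Prop6CubeMember
import Literature.MathematicalPhysics.QuantumFieldTheory.Balaban1983to89.B8LeafSocketsB9

/-!
# `Balaban1983to89.B8SockHFPCubeMember` — [Balaban1985RegularSpaces] the Proposition-5 fixed-point sockets `SockHFP₀`∕`SockHFP` of the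
# N05 knit AT THE CONCRETE CUBE MEMBER `{□_j}` of (1.131): the two MEMBER LAWS of n05-d's `B8SockHFPOfSockLetters` (towers of every
# truncation inside `Ω_j`; the truncation law (1.68) between consecutive levels — referee WATCH-J2 = W7) are THEOREMS for the cube member,
# so that at this member the sockets follow from the [4]-letters socket `SockLetters` and the b9 socket `SB9all` ALONE

statement-level skeleton of published theorems with citation tags; proofs where landed; nothing here is a claim about the
Yang–Mills mass gap

T. Bałaban, *Spaces of regular gauge field configurations on a lattice and gauge fixing conditions*, Commun. Math. Phys. **99**
(1985) 75–102 `[Balaban1985RegularSpaces]` ("B8"), Prop. 5 p. 94, (1.68) p. 88, (1.5)–(1.6) p. 77, (1.131) p. 99.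

CITATION HEADER (lean-in-tree rule).  Cell `pub-ymgap` (YM Track A, HUMAN RULING D-0062), DAG node N05 = [B8], seat `pub-ymgap-dag-n05-c`
(R134 fan-out; FAN-OUT v1.1 §N05 row s3b).  WHY: `B8SockHFPOfSockLetters.exists_threshold_sockHFP_pair` (n05-d, p456870) turns the knit's
Prop.-5 sockets into theorems modulo `SockLetters` + `SB9all` + FOUR member laws displayed as hypotheses (`hbox`, `hclass`, towers `htw` at
EVERY truncation level, the truncation laws `h8lt`∕`h8top`); ref-A g12 READ-3 (W7 = WATCH-J2): «for the cube member they are n05-c's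
`cubeLamS_of_lt`∕`cubeLamS_self`∕`cubeLamS_cover`, to be matched BY NAME».  THIS FILE does the matching: §1 proves the four laws for
`(Ω, Λs, Λb) := (cubeFam false, cubeLamS, cubeLamB)` of `B8CubeMemberZd`; §2 `sockHFP_pair_cubeMember` = the two sockets at the cube member
from `SockLetters` + `SB9all` at the member (threshold `cF` of n05-d's theorem).  Kind «kernel-checked proof», theorems only.

HONEST SCOPE.  Geometry of print's own cube family + one `exact`; the letters and the b9 socket remain hypotheses (object-bound); count-
neutral; N05 NOT discharged; `T_η ↦ ℤᵈ`; nothing continuum ∕ ℝ⁴ ∕ OS ∕ mass-gap ∕ Clay.  Unit `pub-ymgap-dag-n05-c` (g0), 2026-08-26.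
VERSION v1.1 (same seat, APPEND-ONLY §3; + imports `B8Prop6CubeMember`, `B8LeafSocketsB9`): **`prop6_cubeMember_of_letters`** — PROPOSITION 6
(p. 99) at the cube member WITH PRINT'S HYPOTHESES, the Prop.-5 ∃ sockets DISCHARGED by §2 and the (1.59) socket read from the b9 ∃-package
(`B8LeafSocketsB9.sockH59_of_allLevels`): it rests on exactly THREE object-bound sockets at the member — the [4]-letters `SockLetters`, the b9
socket `SB9all` (every truncation) and Prop. 5's uniqueness `SockP5u` — the same three as the prototype knit after n05-d's p456870.  §§1–2
unchanged.

SCOPE NOTE (v-scope, 2026-08-27, seat pub-ymgap-dag-n05-c g11; director-ym LINE №196; NO statement change).  Every hypothesis of this file that is a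
(1.59)-type socket read over the typed constraint-bond class `B8CubeMemberZd.cubeLamB` ∕ `B8IdxB8LawsB.towerBonds` (`SockH59`-, `SockB9P3`-shaped
binders: Theorem 4's ∕ Proposition 3's frame) is UNINHABITED at every nested member with `k ≥ 1` as soon as the socket is owed at the flat background
`U₀ = 1` (interior shell gauge modes — kernel certificates `B8Ineq159FlatShellModeVacuity` p572834, `B8SockB9P3ShellModeVacuityUniv` p576185; root
cause: the class has no crossing bond, `B8Ineq159FlatCubeMemberPrinted.towerBonds_inner_of_printTower`).  The theorems below stay TRUE (PASS-AS-DECLARED) and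
are VACUOUS wherever such a socket is among their hypotheses; the repaired class is `B8Ineq159FlatCubeMemberPrinted.cubeLamBP` (print's (1.31)∕[B6] (2.3)),
over which the consumers are being re-typed (edition γ).  Sockets over the SITE tower `cubeLamS` only (`SockHFP`, `SockP5u…`, the REAL families, the
𝒢-bound) are NOT affected.

-/

noncomputable section

namespace Literature.MathematicalPhysics.QuantumFieldTheory.Balaban1983to89.B8SockHFPCubeMember

open B7Prop1Explicit B7Prop2Explicit B7Prop1Local
open B8Ineq130 (tlo thi fl inBlock_fl fl_mem)
open B8Ineq132 (Under under_tower)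
open B8Thm2LogB (blockTop)
open B8LeafModelZd3 (SockB9P3)
open B8LeafModelZdOfHFP (SockHFP₀ SockHFP)
open B8LeafModelZd (SockP5u)
open B8LeafModelZdSockLetters (SockLetters)
open B8SockHFPOfSockLetters (exists_threshold_sockHFP_pair)
open B8Thm4TruncationLocal (under_one_of_mem_blockSites mem_blockSites_of_under_one)
open B8Eq131Cubes (cube sqLo sqHi inLo inHi tcube tLo tHi ctr mem_cube_iff inner_eq_blowup inBox_margin_mono)
open B8Eq131CubesAdmissible (cubeFam cubeFam_false_of_le)
open B8CubeMemberZd (cubeLam cubeLamS cubeLamB cubeLamS_of_lt cubeLamS_self inBox_sq_of_mem_cubeLamS inBox_tower_iff_under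
  hΩ_cubeFam hbox_cubeLamB hclass_cubeLamB)
open QuantumLattice (blockSites)

export B7Prop1Explicit (Site)

variable {d : ℕ}

/-! ## §1 The member laws of `B8SockHFPOfSockLetters` for the cube member -/

/-- **Towers of EVERY truncation lie in the cubes** (`htw` of `B8SockHFPOfSockLetters`): for `j ≤ m ≤ k` and `y ∈ cubeLamS … m j ⊂ □_j^{(j)}`, the
level-`j` tower `Bʲ(y)` lies in `Ω_j = □_j` («□_j is a sum of the big blocks of the lattice T_{L^{−j}}», p. 98).
[cite: Balaban1985RegularSpaces, p.98, (1.5)–(1.6) p.77] -/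
theorem htw_cubeLamS {L : ℕ} (hL : 1 ≤ L) (a : Site d) (M ρ k : ℕ) :
    ∀ m, m ≤ k → ∀ j, j ≤ m → ∀ y ∈ cubeLamS L a M ρ k m j, ∀ x, InBox (tlo L y j) (thi L y j) x → x ∈ cubeFam false L a M ρ k j := by
  intro m hm j hj y hy x hx
  rw [cubeFam_false_of_le L a M ρ (hj.trans hm)]
  exact (mem_cube_iff hL).2 ⟨y, inBox_sq_of_mem_cubeLamS hy, (inBox_tower_iff_under L j y x).1 hx⟩

/-- **The truncation law below the truncation level** (`h8lt`): for `j < m < k` the restriction sets of the truncations at `m` and `m + 1` agree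
(both are print's `Λ_j`). [cite: Balaban1985RegularSpaces, (1.68) p.88 («taking Λ_{k−1} ∪ B(Λ_k) as Λ_{k−1}»)] -/
theorem h8lt_cubeLamS (L : ℕ) (a : Site d) (M ρ k : ℕ) :
    ∀ m, m < k → ∀ j, j < m → cubeLamS L a M ρ k m j = cubeLamS L a M ρ k (m + 1) j := by
  intro m _ j hj
  rw [cubeLamS_of_lt L a M ρ k hj, cubeLamS_of_lt L a M ρ k (Nat.lt_succ_of_lt hj)]

/-- `x ∈ B(⌊x∕L⌋)` (one level): `Under L 1 (fl L x) x`. [cite: Balaban1985RegularSpaces, (1.6) p.77] -/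
private theorem under_one_fl {L : ℕ} (hL : 1 ≤ L) (x : Site d) : Under L 1 (fl L x) x := by
  intro i
  obtain ⟨h1, h2⟩ := inBlock_fl hL x i
  simp only [Pi.smul_apply, smul_eq_mul] at h1 h2
  rw [pow_one]
  constructor <;> linarith

/-- **The truncation law AT the truncation level** (`h8top`; (1.68) «taking Λ_{k−1} ∪ B(Λ_k) as Λ_{k−1}» read between the levels `m` and
`m + 1`): `□_m^{(m)} = Λ_m ∪ B(□_{m+1}^{(m+1)})` — a level-`m` site of `□_m^{(m)}` either lies outside `□_{m+1}^{(m)}` (then it is in `Λ_m`) or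
in it, i.e. under a site of `□_{m+1}^{(m+1)}` (`inner_eq_blowup`); conversely `B(□_{m+1}^{(m+1)}) = □_{m+1}^{(m)} ⊂ □_m^{(m)}`.
[cite: Balaban1985RegularSpaces, (1.68) p.88, (1.6) p.77, (1.131) p.99] -/
theorem h8top_cubeLamS {L : ℕ} (hL : 1 ≤ L) (a : Site d) (M ρ k : ℕ) :
    ∀ m, m < k → ∀ x, x ∈ cubeLamS L a M ρ k m m ↔
      x ∈ cubeLamS L a M ρ k (m + 1) m ∨ ∃ y ∈ cubeLamS L a M ρ k (m + 1) (m + 1), x ∈ blockSites L y := by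
  intro m hmk x
  obtain ⟨hlo, hhi⟩ := inner_eq_blowup (L := L) a M ρ hmk
  rw [cubeLamS_self, cubeLamS_of_lt L a M ρ k (Nat.lt_succ_self m), cubeLamS_self]
  simp only [Set.mem_setOf_eq, cubeLam]
  constructor
  · intro hx
    by_cases hin : InBox (inLo L a ρ k m) (inHi L a M ρ k m) x
    · -- `x ∈ □_{m+1}^{(m)} = B(□_{m+1}^{(m+1)})`: the site `⌊x∕L⌋` of `□_{m+1}^{(m+1)}` carries it
      right
      rw [hlo, hhi] at hin
      have h1 : tlo L (sqLo L a ρ k (m + 1)) (0 + 1) ≤ x := fun i => (hin i).1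
      have h2 : x ≤ thi L (sqHi L a M ρ k (m + 1)) (0 + 1) := fun i => (hin i).2
      obtain ⟨hy1, hy2⟩ := fl_mem hL h1 h2
      refine ⟨fl L x, fun i => ⟨?_, ?_⟩, mem_blockSites_of_under_one (under_one_fl hL x)⟩
      · simpa using hy1 i
      · simpa using hy2 i
    · exact Or.inl ⟨hx, fun _ => hin⟩
  · rintro (⟨hx, -⟩ | ⟨y, hy, hxy⟩)
    · exact hx
    · -- `B(y) ⊂ □_{m+1}^{(m)} ⊂ □_m^{(m)}`
      have hU : Under L 1 y x := under_one_of_mem_blockSites hxy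
      obtain ⟨h1, h2⟩ := under_tower (m₀ := 0) (fun i => by simpa using (hy i).1) (fun i => by simpa using (hy i).2) hU
      have hin : InBox (inLo L a ρ k m) (inHi L a M ρ k m) x := by
        rw [hlo, hhi]; exact fun i => ⟨h1 i, h2 i⟩
      exact inBox_margin_mono (Nat.mul_le_mul_left ρ (Nat.sub_le _ 1)) hin

/-! ## §2 The sockets at the cube member from the letters and the b9 socket alone -/

section Sockets

variable {𝔸 : Type*} [CStarAlgebra 𝔸] [Nontrivial 𝔸]

/-- **`SockHFP₀` AND `SockHFP` AT THE CONCRETE CUBE MEMBER FROM `SockLetters` + `SB9all` ALONE** — `B8SockHFPOfSockLetters.exists_threshold_sockHFP_pair`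
(n05-d) with its four member laws DISCHARGED for `(Ω, Λs, Λb) := (cubeFam false, cubeLamS, cubeLamB)` (§1 + `B8CubeMemberZd.hbox_cubeLamB` ∕
`hclass_cubeLamB` ∕ `hΩ_cubeFam`): ONE threshold `cF(d, L, B₀, B₀′, B₀′_H, B₂′, B_G, B_R, c_{B9}, c_L) > 0` such that for every cube datum
`(η > 0, k ≥ 1, a, M, ρ ≥ L)` the [4]-letters socket at the member and the b9 socket at every truncation give both Prop.-5 fixed-point
sockets at the member (referee WATCH-J2∕W7 closed for this member). [cite: Balaban1985RegularSpaces, Prop. 5 (1.106)–(1.109) p.94, (1.68) p.88, (1.131) p.99] -/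
theorem sockHFP_pair_cubeMember (hd2 : 2 ≤ d) {L : ℕ} (hL : 2 ≤ L) {B₀ B₀' B₀'H B₂' BG BR cB9 cL : ℝ} (hB₀ : 0 < B₀)
    (hB₀' : 0 < B₀') (hB : 2 ≤ 5 * (d : ℝ) * L * B₀) (hB₀'H : 0 < B₀'H) (hB₂' : 0 ≤ B₂') (hBG : 0 ≤ BG) (hBR : 0 ≤ BR)
    (hcB9 : 0 < cB9) (hcL : 0 < cL) (hfree : 3 * (2 * (d : ℝ) * (L : ℝ) ^ 2) * BG * BR ≤ B₀') :
    ∃ cF : ℝ, 0 < cF ∧ ∀ {η : ℝ}, 0 < η → ∀ {k : ℕ}, 1 ≤ k → ∀ (a : Site d) (M : ℕ) {ρ : ℕ}, L ≤ ρ →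
      ∀ {B₀β β : ℝ} {len : Site d → ℝ},
      SockLetters (𝔸 := 𝔸) L BG BR B₀'H B₂' cL η k (cubeFam false L a M ρ k) (cubeLamS L a M ρ k) →
      (∀ m, m ≤ k → SockB9P3 (𝔸 := 𝔸) L B₀ B₀β cB9 β len η m (cubeFam false L a M ρ k) (cubeLamS L a M ρ k) (cubeLamB L a M ρ k)) →
        SockHFP₀ (𝔸 := 𝔸) L B₀ B₀' cF η k (cubeFam false L a M ρ k) (cubeLamS L a M ρ k) ∧
        SockHFP (𝔸 := 𝔸) L B₀ B₀' cF η k (cubeFam false L a M ρ k) (cubeLamS L a M ρ k) := by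
  have hL1 : 1 ≤ L := le_trans (by norm_num) hL
  obtain ⟨cF, hcF, H⟩ := exists_threshold_sockHFP_pair (𝔸 := 𝔸) hd2 hL hB₀ hB₀' hB hB₀'H hB₂' hBG hBR hcB9 hcL hfree
  refine ⟨cF, hcF, ?_⟩
  intro η hη k hk a M ρ hρL B₀β β len SLet SB9all
  exact H hη hk (hΩ_cubeFam hL1 a M hρL k) (hbox_cubeLamB L a M ρ k) (hclass_cubeLamB L a M ρ k) (htw_cubeLamS hL1 a M ρ k)
    (h8lt_cubeLamS L a M ρ k) (h8top_cubeLamS hL1 a M ρ k) SLet SB9all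

end Sockets

/-! ## §3 (v1.1) Proposition 6 at the cube member from the three object-bound sockets -/

section Prop6

variable {𝔸 : Type} [CStarAlgebra 𝔸] [Nontrivial 𝔸]


/-- **PROPOSITION 6 (p. 99) AT THE CONCRETE CUBE MEMBER WITH PRINT'S HYPOTHESES, MODULO EXACTLY THREE SOCKETS AT THE MEMBER** — the
[4]-letters socket `SockLetters` (threshold `c_L`), the b9 socket at every truncation `SB9all` (`SockB9P3`, threshold `c_{B9}`) and Proposition 5's
uniqueness `SockP5u` (radius `cu`, threshold `cu′`): `B8Prop6CubeMember.prop6_asPrinted_cubeMember_of_HFP₄` with its `SockHFP₀`∕`SockHFP`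
hypotheses DISCHARGED by `sockHFP_pair_cubeMember` (§2) and its `SockH59` hypothesis read from the b9 ∃-package by
`B8LeafSocketsB9.sockH59_of_allLevels`.  ONE threshold `c₁ > 0` on `(d, L, B₀, B₀′, B₀′_H, B₂′, B_G, B_R, c_{B9}, c_L, cu, cu′)`; conclusion as there
(∃ unitary `u` = 1 off `□₀`, (1.29), (1.38) of record, `U₁ = U₀″^{u⁻¹} = e^{iηA}` with `Lʲη|A| ≤ 7dL²B₁Mα₀`, uniqueness, (1.135) on `□̃`).
[cite: Balaban1985RegularSpaces, Prop. 6 (1.135)–(1.138) p.99, Prop. 5 p.94, (1.59) p.86; Balaban1985BackgroundPropagators, Thm 3.3 p.398] -/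
theorem prop6_cubeMember_of_letters (hd2 : 2 ≤ d) {L : ℕ} (hL : 2 ≤ L) {B₀ B₀' B₀'H B₂' BG BR cB9 cL cu cu' : ℝ} (hB₀ : 0 < B₀)
    (hB₀' : 0 < B₀') (hB : 2 ≤ 5 * (d : ℝ) * L * B₀) (hB₀'H : 0 < B₀'H) (hB₂' : 0 ≤ B₂') (hBG : 0 ≤ BG) (hBR : 0 ≤ BR)
    (hcB9 : 0 < cB9) (hcL : 0 < cL) (hcu : 0 < cu) (hcu' : 0 < cu') (hfree : 3 * (2 * (d : ℝ) * (L : ℝ) ^ 2) * BG * BR ≤ B₀') :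
    ∃ c₁ : ℝ, 0 < c₁ ∧ ∀ (η : ℝ), 0 < η → ∀ (k : ℕ), 1 ≤ k → ∀ (a : Site d) (M ρ : ℕ), L ≤ ρ → ρ ≤ M → 11 * (d : ℝ) < M →
      (L : ℝ) ≤ d * M →
      ∀ {B₀β β : ℝ} {len : Site d → ℝ},
      SockLetters (𝔸 := 𝔸) L BG BR B₀'H B₂' cL η k (cubeFam false L a M ρ k) (cubeLamS L a M ρ k) →
      (∀ m, m ≤ k → SockB9P3 (𝔸 := 𝔸) L B₀ B₀β cB9 β len η m (cubeFam false L a M ρ k) (cubeLamS L a M ρ k) (cubeLamB L a M ρ k)) →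
      SockP5u (𝔸 := 𝔸) L cu' cu η k (cubeFam false L a M ρ k) (cubeLamS L a M ρ k) →
      ∀ (U₀ : Site d → Fin d → 𝔸ˣ), (∀ x κ, U₀ x κ ∈ unitaryUnits 𝔸) → ∀ (α₀ : ℝ), 0 < α₀ →
      ∀ (Ω : ℕ → Set (Site d)), B8Ineq132.InAk L k η α₀ Ω U₀ → tcube L a M ρ k ⊆ Ω (k - 1) →
      7 * d * (L : ℝ) ^ 2 * M * α₀ ≤ c₁ →
      ∃ u : Site d → 𝔸ˣ, (∀ x, u x ∈ unitaryUnits 𝔸) ∧ (∀ x, x ∉ cubeFam false L a M ρ k 0 → u x = 1) ∧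
        B8Eq119TwistedAxial.Restr129 L k (cubeLamS L a M ρ k k) (1 : Site d → Fin d → 𝔸ˣ) u ∧
        B8Eq138LandauZd.IsLandau138W L k η (cubeFam false L a M ρ k 0) (cubeLamS L a M ρ k k) (1 : Site d → Fin d → 𝔸ˣ)
          (gaugeAct u⁻¹ (B8Ineq133.cutFixed L (tLo a ρ) (tHi a M ρ) U₀ k (ctr a M))) ∧
        (∀ j, j ≤ k → ∀ b ∈ {b : Site d × Fin d | B8Eq140Level.SideTouches (cubeFam false L a M ρ k j) b.1 b.2},
          gaugeAct u⁻¹ (B8Ineq133.cutFixed L (tLo a ρ) (tHi a M ρ) U₀ k (ctr a M)) b.1 b.2 =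
              B8Eq184Proof.cfgExp η (B8Eq138LandauZd.logCfg η (gaugeAct u⁻¹ (B8Ineq133.cutFixed L (tLo a ρ) (tHi a M ρ) U₀ k (ctr a M)))) b.1 b.2 ∧
            IsSelfAdjoint (B8Eq138LandauZd.logCfg η (gaugeAct u⁻¹ (B8Ineq133.cutFixed L (tLo a ρ) (tHi a M ρ) U₀ k (ctr a M))) b.1 b.2) ∧
            ‖B8Eq138LandauZd.logCfg η (gaugeAct u⁻¹ (B8Ineq133.cutFixed L (tLo a ρ) (tHi a M ρ) U₀ k (ctr a M))) b.1 b.2‖ ≤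
              (7 * d * (L : ℝ) ^ 2 * (5 * (d : ℝ) * L * B₀) * M * α₀) * ((L : ℝ) ^ j * η)⁻¹) ∧
        (∀ u' : Site d → 𝔸ˣ, (∀ x, u' x ∈ unitaryUnits 𝔸) → (∀ x, x ∉ cubeFam false L a M ρ k 0 → u' x = 1) →
          B8Eq119TwistedAxial.Restr129 L k (cubeLamS L a M ρ k k) (1 : Site d → Fin d → 𝔸ˣ) u' →
          B8Eq138LandauZd.IsLandau138W L k η (cubeFam false L a M ρ k 0) (cubeLamS L a M ρ k k) (1 : Site d → Fin d → 𝔸ˣ)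
            (gaugeAct u'⁻¹ (B8Ineq133.cutFixed L (tLo a ρ) (tHi a M ρ) U₀ k (ctr a M))) →
          (∃ A' : Site d → Fin d → 𝔸, ∀ j, j ≤ k → ∀ (x : Site d) (κ : Fin d), B8Eq140Level.SideTouches (cubeFam false L a M ρ k j) x κ →
            gaugeAct u'⁻¹ (B8Ineq133.cutFixed L (tLo a ρ) (tHi a M ρ) U₀ k (ctr a M)) x κ = B8Eq184Proof.cfgExp η A' x κ ∧
              ‖A' x κ‖ ≤ (5 * (d : ℝ) * L * B₀ * ((L : ℝ) ^ 3 * α₀ + 6 * d * (L : ℝ) ^ 2 * M * α₀)) * ((L : ℝ) ^ j * η)⁻¹) →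
          u' = u) ∧
        (∀ x, ((B8Eq115GaugeFixing.localGauge L (tLo a ρ) (tHi a M ρ) U₀ k (ctr a M))⁻¹ * u) x ∈ unitaryUnits 𝔸) ∧
        AgreeOn (tlo L (tLo a ρ) k) (thi L (tHi a M ρ) k)
          (gaugeAct ((B8Eq115GaugeFixing.localGauge L (tLo a ρ) (tHi a M ρ) U₀ k (ctr a M))⁻¹ * u)⁻¹ U₀)
          (gaugeAct u⁻¹ (B8Ineq133.cutFixed L (tLo a ρ) (tHi a M ρ) U₀ k (ctr a M))) := by
  have hL1 : 1 ≤ L := le_trans (by norm_num) hL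
  have hd1 : 1 ≤ d := le_trans (by norm_num) hd2
  obtain ⟨cF, hcF, HF⟩ := sockHFP_pair_cubeMember (𝔸 := 𝔸) hd2 hL hB₀ hB₀' hB hB₀'H hB₂' hBG hBR hcB9 hcL hfree
  -- the (1.59) threshold delivered by the b9 ∃-package adapter
  set c59 : ℝ := min cB9 (cB9 / (2 * (L * (5 * (d : ℝ) * L * B₀)) + 8 * (8 * B₀' * (5 * (d : ℝ) * L * B₀)))) with hc59def
  have hc59 : 0 < c59 := by
    have hden : 0 < 2 * (L * (5 * (d : ℝ) * L * B₀)) + 8 * (8 * B₀' * (5 * (d : ℝ) * L * B₀)) := by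
      have hLpos : (0 : ℝ) < L := by exact_mod_cast lt_of_lt_of_le (by norm_num) hL
      have hdpos : (0 : ℝ) < d := by exact_mod_cast hd1
      positivity
    exact lt_min hcB9 (div_pos hcB9 hden)
  obtain ⟨c₁, hc₁, H⟩ := B8Prop6CubeMember.prop6_asPrinted_cubeMember_of_HFP₄ (𝔸 := 𝔸) hd2 hL hB₀ hB₀' hB hcu hcF hcF hc59 hcu'
  refine ⟨c₁, hc₁, ?_⟩
  intro η hη k hk a M ρ hρL hρM hM hLdM B₀β β len SLet SB9all SP5u U₀ hU₀ α₀ hα Ω hA hT hc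
  obtain ⟨SHFP₀, SHFP⟩ := HF hη hk a M hρL SLet SB9all
  have SH59 := B8LeafSocketsB9.sockH59_of_allLevels (𝔸 := 𝔸) hd1 hL1 hB₀ hB₀'.le hcB9 SB9all
  exact H η hη k hk a M ρ hρL hρM hM hLdM SHFP₀ SHFP SH59 SP5u U₀ hU₀ α₀ hα Ω hA hT hc

#print axioms prop6_cubeMember_of_letters

end Prop6

#print axioms h8top_cubeLamS
#print axioms sockHFP_pair_cubeMember

end Literature.MathematicalPhysics.QuantumFieldTheory.Balaban1983to89.B8SockHFPCubeMember

end
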